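import Summits.ResolutionOfSingularities.ResolutionOfSingularities.Theorems.HilbertSamuelEliminationCampaignW42RidgeConfinesChartOfPermissible
import Literature.AlgebraicGeometry.Resolution.BlowupStalkCharts
import Literature.AlgebraicGeometry.Resolution.PointBlowupHilbertSamuelStrata
import Literature.AlgebraicGeometry.Resolution.QuasiExcellentSchemes
import Literature.AlgebraicGeometry.Resolution.ExcellentRingsFieldProofs
import HarnessLib

/-!
# [OURS · L1 W4.2] `CampaignW42RidgeConfines p` HOLDS: near points of a permissible blow-up of a reduced separated scheme of
# finite type over a field of characteristic `p` are confined to Giraud's ridge — the CONFINEMENT HALF of the informal crux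
# `RidgeConfinement` (stmt-ResolutionOfSingularities-17845) in its typed OURS form (p480040), every `p`, every residue field
# (campaign s42, cell res-hironaka; `--supports`)

HONEST FRAMING. OURS (slot W4.2, prover res-L1-s42-pv-1, gen 3): the scheme-level assembly. The local-ring theorem
`CampaignW42.ridgeConfinedAt_of_isNearRing` (`…RidgeConfinesChartOfPermissible.lean`) is generalised to an arbitrary
presentation of the local ring of the near point and an arbitrary test algebra (`ridgeConfinedAt_of_isNearRing_of_ringHom`),
and read at the stalks of a blowing up through the tree's `IsBlowup.exists_reesChart_stalk` (`BlowupStalkCharts.lean`: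
`𝒪_{X',x'}` is a localization of a chart `𝒪_{X,x}[𝓘_x/c_j]` at a prime over `𝔪_x`, compatibly with `π♯`), the stalks of
a scheme locally of finite type over a field being universally catenary (`Scheme.isExcellent_of_locallyOfFiniteType`,
`Scheme.IsExcellent.isUniversallyCatenaryRing_stalk`) and a permissible `D` being permissible in every stalk
(`IdealSheafData.IsPermissible`, `Ideal.IsPermissible`):

* `ridgeConfinedAt_smul` — `RidgeConfinedAt` is stable under rescaling the direction by a unit (the ridge is a cone);
* `ridgeConfinedAt_of_isNearRing_of_ringHom` — the point-level confinement for ANY localization `𝒪'` of the chart at a prime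
  over `𝔫` near to `A`, and ANY `θ : A[𝔭/c_j] → κ` killing that prime, compatible with `k → κ`;
* **`CampaignW42.ridgeConfinedPoint_of_isNearPoint`** — for `X` locally noetherian with universally catenary stalk at
  `x = π x'`, `D` permissible at `x`, `π` a blow-up along `D`, `x'` near at level `N`: `RidgeConfinedPoint D π x'`;
* **`campaignW42RidgeConfines_holds : CampaignW42RidgeConfines p`** for every `p` (the separatedness / quasi-compactness /
  reducedness / `char p` / `N ≥ dim X` hypotheses of the OURS statement are not needed and not used).

With this, the FIRST conjunct of the proposed typed signature `CampaignW42RidgeConfinement p = CampaignW42RidgeConfines p ∧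
RidgeDimMonotone p` of stmt-17845 is PROVED; the second (monotonicity of the ridge DIMENSION, the analogue of CJS Thm. 3.10 (4))
is untouched. NOTHING here is a statement of H. Hironaka's manuscript [Hironaka2017]. AI review is weaker than expert review.
References (orientation only): V. Cossart, U. Jannsen, S. Saito, LNM 2270 (2020), Def. 3.1, Thm. 3.14, Rem. 18.29 (1);
J. Giraud, Ann. Sci. ÉNS (4) 8 (1975), Cor. 2.4; The Stacks Project, Tags 0804, 07QW.
-/

noncomputable section

-- single-conjunct summit: the doubled namespace component `ResolutionOfSingularities` is mandated
set_option linter.dupNamespace false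

open CategoryTheory AlgebraicGeometry IsLocalRing MvPolynomial
open Literature.RingTheory.HilbertSamuel Literature.RingTheory.MvPolynomial
open Literature.AlgebraicGeometry.Resolution

namespace Summit.ResolutionOfSingularities.ResolutionOfSingularities.Theorems

namespace CampaignW42

universe u

/-! ## The point-level confinement: rescaling, and arbitrary presentations of the near local ring -/

section Local

variable {A : Type u} [CommRing A] [IsLocalRing A] [IsNoetherianRing A] {k : ℕ} (c : Fin k → A) (j : Fin k)

local notation3 "𝔭" => Ideal.span (Set.range c)

/-- **`RidgeConfinedAt` is stable under rescaling by a unit** (the ridge is a cone, degree-one initial forms are linear).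
[cite: Giraud1975, §1.5] -/
theorem ridgeConfinedAt_smul {κ : Type u} [CommRing κ] [Algebra (ResidueField A) κ] {ubar : Fin k → κ}
    (h : RidgeConfinedAt A c κ ubar) {e : κ} (he : IsUnit e) : RidgeConfinedAt A c κ (fun l => e * ubar l) := by
  obtain ⟨v, hv, hvL⟩ := h
  refine ⟨e • v, smul_mem_localRidge A he hv, fun l L hL => ?_⟩
  rw [aeval_smul_of_isHomogeneous (isHomogeneous_of_mem_initialFormsOf (minGenerators A) hL) e v, pow_one, hvL l L hL]

/-- **The point-level confinement for an arbitrary presentation of the near local ring and an arbitrary test algebra.**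
`A` noetherian local universally catenary, `𝔭 = (c)` permissible, `P` a prime of the chart `A[𝔭/c_j]` over `𝔫`, `𝒪'` any
localization of the chart at `P` (as an `A`-algebra through the chart) NEAR to `A` at level `N`, `θ : A[𝔭/c_j] → κ` killing
`P` and compatible with `k → κ`: `RidgeConfinedAt A c κ (θ(c_l/c_j))_l`. [cite: CossartJannsenSaito2020, Thm. 3.14]
[cite: Giraud1975, Cor. 2.4] -/
theorem ridgeConfinedAt_of_isNearRing_of_ringHom (hO : IsUniversallyCatenaryRing A) [(𝔭).IsPrime]
    [IsRegularLocalRing (A ⧸ 𝔭)] (hNF : (𝔭).IsNormallyFlat) (P : Ideal (chartRing c j)) [P.IsPrime]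
    (O' : Type u) [CommRing O'] [Algebra (chartRing c j) O'] [IsLocalization.AtPrime O' P] [IsLocalRing O'] [Algebra A O']
    (hP : P.comap (chartBase c j) = maximalIdeal A)
    (hOO' : ∀ r : A, algebraMap A O' r = (algebraMap (chartRing c j) O' : chartRing c j →+* O') (chartBase c j r))
    {N : ℕ} (hnear : IsNearRing A O' N)
    {κ : Type u} [CommRing κ] [Algebra (ResidueField A) κ] (θ : chartRing c j →+* κ)
    (hθP : ∀ x ∈ P, θ x = 0) (hθ : ∀ r : A, θ (chartBase c j r) = algebraMap (ResidueField A) κ (residue A r)) :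
    RidgeConfinedAt A c κ (fun l => θ (chartGen c j l)) := by
  classical
  set ubar : Fin k → κ := fun l => θ (chartGen c j l) with hubar
  -- (1) the direction lies in the ridge of the FIBRE cone
  have hū : ubar ∈ ridge κ (fibreConeIdeal c) :=
    aeval_chartGen_mem_ridge_of_isNearRing c j P O' hO hNF hP hOO' hnear θ hθP hθ
  -- (2) generators `(y, c)` of `𝔫`; Hironaka–Grothendieck at the near point
  obtain ⟨s, hs⟩ := exists_ringKrullDim_quotient_eq_nat A (𝔭)
  obtain ⟨y, hy⟩ := exists_maximalIdeal_eq_sup_span_range (𝔭) hs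
  have hc' : Ideal.span (Set.range (frontAppend y c)) = maximalIdeal A := by
    rw [span_range_frontAppend, sup_comm, ← hy]
  have hHG := fibreConeIdeal_frontAppend_eq_coneExtend_of_isNearRing c y j P O' hO hs hNF hy hP hOO' hnear
  -- (3) `(0, ū)` is a point of the ridge of the tangent cone read in `(y, c)`
  have hw : frontAppend (0 : Fin s → κ) ubar ∈ ridge κ (tangentConeIdeal (frontAppend y c) hc') := by
    rw [← fibreConeIdeal_eq_tangentConeIdeal (frontAppend y c) hc', hHG]
    exact frontAppend_zero_mem_ridge_coneExtend s hū
  -- (4) transport to the minimal generators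
  set x := minGenerators A
  have hx : Ideal.span (Set.range x) = maximalIdeal A := span_range_minGenerators A
  have hxa : ∀ i, ∃ ai : Fin (k + s) → A, ∑ l, ai l * frontAppend y c l = x i := fun i =>
    Ideal.mem_span_range_iff_exists_fun.mp (by
      rw [hc', ← hx]; exact Ideal.subset_span ⟨i, rfl⟩)
  choose a ha using hxa
  have hxb : ∀ l, ∃ bl : Fin (maximalIdeal A).spanFinrank → A, ∑ i, bl i * x i = frontAppend y c l := fun l =>
    Ideal.mem_span_range_iff_exists_fun.mp (by
      rw [hx, ← hc']; exact Ideal.subset_span ⟨l, rfl⟩)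
  choose b hb using hxb
  obtain ⟨v, hv, hvw⟩ := exists_mem_ridge_of_mem_ridge_tangentConeIdeal hx rfl hc'
    (a := Matrix.of a) (fun i => by simpa using (ha i).symm)
    (b := Matrix.of b) (fun l => by simpa using (hb l).symm) hw
  -- (5) values on the degree-one initial forms of `c_l`
  refine ⟨v, (mem_localRidge_iff A).mpr hv, fun l L hL => ?_⟩
  set L₀ : MvPolynomial (Fin (maximalIdeal A).spanFinrank) (ResidueField A) :=
    ∑ i, C (residue A (b (l.addNat s) i)) * X i with hL₀
  have hL₀mem : L₀ ∈ initialFormsOf x (c l) 1 := by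
    refine ⟨∑ i, C (b (l.addNat s) i) * X i, IsHomogeneous.sum _ _ _ fun i _ => isHomogeneous_C_mul_X _ i, ?_, ?_⟩
    · rw [← frontAppend_addNat y c l, ← hb (l.addNat s), map_sum]
      simp
    · simp [hL₀, map_sum]
  have hL₀v : aeval v L₀ = ubar l := by
    rw [← frontAppend_addNat (0 : Fin s → κ) ubar l, ← hvw (l.addNat s), hL₀, map_sum]
    simp [Matrix.of_apply]
  have hdiff : aeval v (L - L₀) = 0 :=
    aeval_eq_zero_of_mem_ridge (tangentConeIdeal_le_ker_constantCoeff x hx) hv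
      (mem_tangentConeIdeal_of_mem_symbolForms x hx 1 (sub_mem_symbolForms_of_mem_initialFormsOf x hx hL hL₀mem))
  rw [map_sub, sub_eq_zero] at hdiff
  rw [hdiff, hL₀v]

end Local

/-! ## Schemes -/

section Schemes

variable {X X' : Scheme.{u}} [IsLocallyNoetherian X] {π : X' ⟶ X} {D : X.IdealSheafData}

set_option maxHeartbeats 400000 in
/-- **Near points of a permissible blow-up are confined to the ridge (scheme points, stalk form).** Let `X` be locally
noetherian, `π : X' → X` a blow-up along `D` (`IsBlowup`), `x' ∈ X'` over `x = π x' ∈ V(D)` with `D` permissible at `x` and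
`𝒪_{X,x}` universally catenary, and `x'` NEAR at level `N` (`IsNearPoint`). Then `RidgeConfinedPoint D π x'`: for every
system of generators `c` of `𝓘_{D,x}`, every `j` and `u` with `π♯ c_l = u_l π♯ c_j`, the residues `(ū_l)_l` are
`RidgeConfinedAt` over `κ(x')`. [cite: CossartJannsenSaito2020, Thm. 3.14] [cite: Giraud1975, Cor. 2.4] -/
theorem ridgeConfinedPoint_of_isNearPoint [IsLocallyNoetherian X'] (hπ : IsBlowup π D) (x' : X')
    (hperm : IdealSheafData.IsPermissibleAt D (π.base x'))
    (hUC : IsUniversallyCatenaryRing (X.presheaf.stalk (π.base x'))) {N : ℕ} (hnear : IsNearPoint π N x') :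
    RidgeConfinedPoint D π x' := by
  classical
  intro k c hc j u hu
  letI algκ : Algebra (ResidueField (X.presheaf.stalk (π.base x'))) (ResidueField (X'.presheaf.stalk x')) :=
    (ResidueField.map (π.stalkMap x').hom).toAlgebra
  -- a chart through `x'`
  obtain ⟨j₀, 𝔴, χ, hχ, hloc, h𝔴⟩ := hπ.exists_reesChart_stalk x' c hc
  letI algCO : Algebra (chartRing c j₀) (X'.presheaf.stalk x') := χ.toAlgebra
  letI algRO : Algebra (X.presheaf.stalk (π.base x')) (X'.presheaf.stalk x') := (π.stalkMap x').hom.toAlgebra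
  haveI : IsLocalization.AtPrime (X'.presheaf.stalk x') 𝔴.asIdeal := hloc
  -- permissibility at `x`
  have hp : (Ideal.span (Set.range c)).IsPermissible := by rw [hc]; exact hperm
  haveI : IsRegularLocalRing (X.presheaf.stalk (π.base x') ⧸ Ideal.span (Set.range c)) := hp.1
  haveI : IsDomain (X.presheaf.stalk (π.base x') ⧸ Ideal.span (Set.range c)) := isDomain_of_isRegularLocalRing _
  haveI : (Ideal.span (Set.range c)).IsPrime := (Ideal.Quotient.isDomain_iff_prime _).mp inferInstance
  have hOO' : ∀ r : X.presheaf.stalk (π.base x'),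
      algebraMap (X.presheaf.stalk (π.base x')) (X'.presheaf.stalk x') r =
        (algebraMap (chartRing c j₀) (X'.presheaf.stalk x') : chartRing c j₀ →+* X'.presheaf.stalk x') (chartBase c j₀ r) :=
    fun r => (hχ r).symm
  have hnear' : IsNearRing (X.presheaf.stalk (π.base x')) (X'.presheaf.stalk x') N := hnear
  -- the test map `θ = residue ∘ χ : chart → κ(x')`
  let θ : chartRing c j₀ →+* ResidueField (X'.presheaf.stalk x') := (residue (X'.presheaf.stalk x')).comp χ
  have hθP : ∀ z ∈ 𝔴.asIdeal, θ z = 0 := fun z hz => by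
    change residue (X'.presheaf.stalk x') (χ z) = 0
    rw [residue_eq_zero_iff]
    exact (IsLocalization.AtPrime.to_map_mem_maximal_iff (X'.presheaf.stalk x') 𝔴.asIdeal z).mpr hz
  have hθ : ∀ r : X.presheaf.stalk (π.base x'), θ (chartBase c j₀ r) =
      algebraMap (ResidueField (X.presheaf.stalk (π.base x'))) (ResidueField (X'.presheaf.stalk x'))
        (residue (X.presheaf.stalk (π.base x')) r) := fun r => by
    change residue (X'.presheaf.stalk x') (χ (chartBase c j₀ r)) =
      ResidueField.map (π.stalkMap x').hom (residue (X.presheaf.stalk (π.base x')) r)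
    rw [hχ, ResidueField.map_residue]
  have key := ridgeConfinedAt_of_isNearRing_of_ringHom c j₀ hUC hp.2.1 𝔴.asIdeal (X'.presheaf.stalk x') h𝔴 hOO' hnear'
    θ hθP hθ
  -- from the chart `j₀` to the given `j`, `u`: `u_l = χ(e_l) · u_{j₀}`, `u_{j₀}` a unit
  have ht₀ : (π.stalkMap x').hom (c j₀) ∈ nonZeroDivisors (X'.presheaf.stalk x') := by
    rw [← hχ]
    exact IsLocalization.nonZeroDivisors_le_comap (M := 𝔴.asIdeal.primeCompl) (S := X'.presheaf.stalk x')
      (reesChartBase_mem_nonZeroDivisors (c j₀) (Ideal.mem_span_range_self (f := c) (x := j₀)))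
  have hcl : ∀ l, (π.stalkMap x').hom (c l) = χ (chartGen c j₀ l) * (π.stalkMap x').hom (c j₀) := fun l => by
    rw [← hχ, ← hχ, reesChartBase_apply_eq_mul_chartGen c j₀ l, map_mul, mul_comm]
  have hunit : u j₀ * χ (chartGen c j₀ j) = 1 := by
    have h1 : (1 - u j₀ * χ (chartGen c j₀ j)) * (π.stalkMap x').hom (c j₀) = 0 * (π.stalkMap x').hom (c j₀) := by
      have h := hu j₀
      rw [hcl j] at h
      linear_combination h
    have h2 : 1 - u j₀ * χ (chartGen c j₀ j) = 0 := (mul_cancel_right_mem_nonZeroDivisors ht₀).mp h1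
    linear_combination -h2
  have hul : ∀ l, u l = χ (chartGen c j₀ l) * u j₀ := fun l => by
    have h := hu l
    rw [hcl j, hcl l, ← mul_assoc] at h
    have h2 := (mul_cancel_right_mem_nonZeroDivisors ht₀).mp h
    calc u l = u l * (u j₀ * χ (chartGen c j₀ j)) := by rw [hunit, mul_one]
      _ = (u l * χ (chartGen c j₀ j)) * u j₀ := by ring
      _ = χ (chartGen c j₀ l) * u j₀ := by rw [← h2]
  have hres : (fun l => residue (X'.presheaf.stalk x') (u l)) =
      fun l => residue (X'.presheaf.stalk x') (u j₀) * θ (chartGen c j₀ l) := by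
    funext l
    rw [hul l, map_mul, mul_comm]
    rfl
  rw [hres]
  exact ridgeConfinedAt_smul c key ((IsUnit.of_mul_eq_one _ hunit).map (residue (X'.presheaf.stalk x')))

/-- **`CampaignW42RidgeConfines p` holds** (the confinement half of the informal crux `RidgeConfinement`, stmt-17845, in its
typed OURS form p480040): for every field `k` of characteristic `p`, every reduced separated `X` of finite type over `k`,
every permissible `D`, every blow-up `π : X' → X` along `D`, every `N ≥ dim X` and every point `x'` over `V(D)` near at level
`N`, `RidgeConfinedPoint D π x'`. [cite: CossartJannsenSaito2020, Thm. 3.14] [cite: Giraud1975, Cor. 2.4] -/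
theorem campaignW42RidgeConfines_holds (p : ℕ) : CampaignW42RidgeConfines.{u} p := by
  intro k _ _ X _ f _ hft _ _ D hD X' _ π hπ N _ x' hx' hnear
  haveI := hft
  have hexc : Scheme.IsExcellent X := Scheme.isExcellent_of_locallyOfFiniteType Stacks07QW_field_holds f
  exact ridgeConfinedPoint_of_isNearPoint hπ x' (hD _ hx') (hexc.isUniversallyCatenaryRing_stalk _) hnear

end Schemes

end CampaignW42

end Summit.ResolutionOfSingularities.ResolutionOfSingularities.Theorems

end
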